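import Literature.NumberTheory.Rogawski1990.ArchSchwartzOrbitalIntegralConvergenceTotal   -- ★ p848924∕p849061: `integrable_orbitalIntegrand_of_archSchwartzGL_of_placewise_growth'` (the junction head)
import Literature.NumberTheory.Rogawski1990.ArchEllipticPlaceQuotientGrowth                -- ★ p849105 (#20): `quotientMeasure_hsOrbitBall_le_sqrt_of_elliptic`
import Literature.NumberTheory.Rogawski1990.ArchHyperbolicOrbitMeasureHaarTransport         -- ★ p849082 (LH2-p04 #19): `exists_measure_descConj_hs_add_one_le_rpow_of_diag_haar`
import Literature.NumberTheory.Rogawski1990.ArchPlaneRegularDichotomy                      -- ★ p849157 (LH3-p01 #21): `exists_conj_torusMatrix_or_diagonal_archLocal`, `charpoly_archPiEquivCM_separable_of_isArchGRegular`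
import Literature.NumberTheory.Automorphic.UnitaryGroupArchUnimodular                       -- ★ `modularCharacterFun_archLocal_eq_one`, `antidiagOne_isHermitian`, `isUnit_antidiagOne_det`
import Literature.NumberTheory.Automorphic.GLnAdelicIntegrationFactsProofs                  -- ★ `isMulRightInvariant_of_modularCharacterFun_eq_one`
import Literature.NumberTheory.Automorphic.GLnIwasawaIntegration                            -- ★ `isInvInvariant_of_isMulRightInvariant`
import Literature.NumberTheory.Automorphic.OrbitalMeasureFamilyRegular                      -- ★ `commute_of_charpoly_separable`
import Literature.MeasureTheory.Group.InvariantQuotientAbelian                              -- ★ `isInvInvariant_of_comm`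
import HarnessLib

/-!
# (CONV) at every `G`-regular class of `H_∞`, UNCONDITIONAL: the orbital integrand of an archimedean Schwartz function is integrable for every Weil-form orbital family
# (FINAL head of line LH3's convergence chain; Beuzart-Plessis 2020 §1.5, §1.8; Rogawski 1990 §4.3)

Topic `NumberTheory/Rogawski1990`; namespace `Literature.NumberTheory.Rogawski1990`.  THEOREMS ONLY (no `def`, no instance, no notation, no axiom, no named fact,
no `sorry`).  Cell `pub/hodgecm-mathlib`, crux H413 (`stmt-HodgeConjecture-24833`), F0∕P3c line LH3, «FINAL ED. 3» of LH3-plan (g0)'s DEAL #20 (2026-09-02T04:15:58Z;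
seat LH3-p04 (g0)) — filed as a SIBLING of ★ `ArchSchwartzOrbitalIntegralConvergenceTotal` (400-line rule) rather than as its third edition.

THE HEAD `integrable_orbitalIntegrand_of_archSchwartzGL_of_isArchGRegular`: for every Haar `ν_H` on `H_∞ = U(Φ₂)(L⁺ ⊗ ℝ) × U(Φ₁)(L⁺ ⊗ ℝ)`, every orbital family `m_H`
that is the Weil-form quotient `dν_H ∕ dt_H` at the `G`-regular classes (★ `IsQuotientOf`), every `g : H_∞ → ℂ` with ★ `ArchSchwartzGL L 3 𝔩 (1∕2) ι_∞ g` (two-sided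
`U(𝔩)`-derivatives decaying like `‖ι_∞(·)‖_HS^{-1∕2}` — every `ArchSchwartzEndo` function qualifies, ★ `archSchwartzGL_endoEmbArch_of_archSmooth₂`), and every `G`-regular
class `c`, `Integrable (x̄ ↦ g(x̄ γ x̄⁻¹)) (m_H c)` — NO hypothesis beyond `G`-regularity: the regular dichotomy in `U(Φ₂)(ℂ) ≅ U(1,1)` (compact torus `torusMatrix l₁ l₂` or
split torus `diag(l₁, l₂)`) is LH3-p01's ★ `exists_conj_torusMatrix_or_diagonal_archLocal` (p849157), the per-place Weil-form quotients `μ_w = dν_w ∕ dρ_w` are built from Haar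
data inside the proof (`ν_w` right-invariant by unimodularity ★ `modularCharacterFun_archLocal_eq_one`; `ρ_w` inversion-invariant because `Z(γ_w)` is abelian at the
regular `γ_w` — ★ `charpoly_archPiEquivCM_separable_of_isArchGRegular`, ★ `commute_of_charpoly_separable`, ★ `isInvInvariant_of_comm`), the elliptic places are discharged by
★ `quotientMeasure_hsOrbitBall_le_sqrt_of_elliptic` (p849105) and the split places by LH2-p04's ★ `exists_measure_descConj_hs_add_one_le_rpow_of_diag_haar` (p849082) through
the carrier identity `U(Φ₂)(ℂ)_w = U(Φ₂^ℂ)` (★ `antidiagOne_map`).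
HONEST LABEL: HC_CM is proved only modulo the 7 printed citations (2 remaining: hLiu418 = stmt-HodgeConjecture-24832, h413 = stmt-HodgeConjecture-24833) until rung 0
closes; this is (CONV) = organ O2's analytic input, now unconditional at every `G`-regular class; it closes no organ of `stub_N9` (O1 Shelstad transfer and O3′ Bouaziz
remain LETTERS).

## References
* [BeuzartPlessis2020Asterisque] R. Beuzart-Plessis, *A local trace formula for the Gan–Gross–Prasad conjecture for unitary groups: the archimedean case*,
  Astérisque 418 (2020), §1.8 p. 39; §1.2 (1.2.2), (1.2.4) p. 21.
* [Bouaziz1994IntegralesOrbitales] A. Bouaziz, *Intégrales orbitales sur les groupes de Lie réductifs*, Ann. Sci. ÉNS (4) 27 (1994) 573–609, §3.1 p. 579.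
* [Rogawski1990] J. D. Rogawski, *Automorphic Representations of Unitary Groups in Three Variables*, Ann. of Math. Stud. 123 (1990), §3.1 p. 19; §4.3 (4.3.1) p. 43; §14.3 p. 234.
-/

set_option autoImplicit false

noncomputable section

open MeasureTheory Set NumberField NumberField.mixedEmbedding
open Literature.MeasureTheory.Group Literature.NumberTheory.Automorphic
open scoped ENNReal MatrixGroups Matrix

namespace Literature.NumberTheory.Rogawski1990

section Final

variable {L : Type} [Field L] [NumberField L] [IsCMField L]

/-- In a subgroup `Γ ≤ GL₂(ℂ)`, the centraliser of an element with separable characteristic polynomial is commutative (★ `commute_of_charpoly_separable`: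
the commutant of a regular semisimple matrix is commutative). [cite: Rogawski1990, §3.1 p. 19] -/
private theorem centralizer_comm_of_charpoly_separable_GL₂ {Γ : Subgroup (GL (Fin 2) ℂ)} (γ : ↥Γ)
    (hsep : (((γ : GL (Fin 2) ℂ)) : Matrix (Fin 2) (Fin 2) ℂ).charpoly.Separable) :
    ∀ x ∈ Subgroup.centralizer ({γ} : Set ↥Γ), ∀ y ∈ Subgroup.centralizer ({γ} : Set ↥Γ), x * y = y * x := by
  intro x hx y hy
  rw [Subgroup.mem_centralizer_singleton_iff] at hx hy
  have hx' : Commute (((γ : GL (Fin 2) ℂ)) : Matrix (Fin 2) (Fin 2) ℂ) (((x : GL (Fin 2) ℂ)) : Matrix (Fin 2) (Fin 2) ℂ) := by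
    have h := congrArg (fun z : ↥Γ => (((z : GL (Fin 2) ℂ)) : Matrix (Fin 2) (Fin 2) ℂ)) hx
    simp only [Subgroup.coe_mul, Units.val_mul] at h
    exact h.symm
  have hy' : Commute (((γ : GL (Fin 2) ℂ)) : Matrix (Fin 2) (Fin 2) ℂ) (((y : GL (Fin 2) ℂ)) : Matrix (Fin 2) (Fin 2) ℂ) := by
    have h := congrArg (fun z : ↥Γ => (((z : GL (Fin 2) ℂ)) : Matrix (Fin 2) (Fin 2) ℂ)) hy
    simp only [Subgroup.coe_mul, Units.val_mul] at h
    exact h.symm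
  have hc := Literature.LinearAlgebra.Matrix.commute_of_charpoly_separable _ hsep hx' hy'
  exact Subtype.ext (Units.ext (by simpa only [Subgroup.coe_mul, Units.val_mul] using hc.eq))

variable
    [MeasurableSpace ((↥(UnitaryGroup.arch (↥(maximalRealSubfield L)) L (IsCMField.complexConj L) 2
          (Matrix.of fun i j : Fin 2 => if i.val + j.val + 1 = 2 then (1 : L) else 0)) ×
        ↥(UnitaryGroup.arch (↥(maximalRealSubfield L)) L (IsCMField.complexConj L) 1
          (Matrix.of fun i j : Fin 1 => if i.val + j.val + 1 = 1 then (1 : L) else 0))))]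
    [BorelSpace ((↥(UnitaryGroup.arch (↥(maximalRealSubfield L)) L (IsCMField.complexConj L) 2
          (Matrix.of fun i j : Fin 2 => if i.val + j.val + 1 = 2 then (1 : L) else 0)) ×
        ↥(UnitaryGroup.arch (↥(maximalRealSubfield L)) L (IsCMField.complexConj L) 1
          (Matrix.of fun i j : Fin 1 => if i.val + j.val + 1 = 1 then (1 : L) else 0))))]

/-- **(CONV) AT EVERY `G`-REGULAR CLASS — UNCONDITIONAL.**  For every Weil-form orbital family `(m_H, ν_H, t_H)` on `H_∞` (★ `IsQuotientOf` at the
`G`-regular classes), every `g` with two-sided `U(𝔩)`-derivative decay of weight `‖·‖_HS^{-1∕2}` through `ι_∞` (★ `ArchSchwartzGL L 3 𝔩 (1∕2) ι_∞ g` — e.g. every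
`ArchSchwartzEndo` function, ★ `archSchwartzGL_endoEmbArch_of_archSmooth₂`), and every `G`-regular class `c`, the orbital integrand `x̄ ↦ g(x̄ γ x̄⁻¹)` is `m_H(c)`-integrable.
PROOF: ★ `integrable_orbitalIntegrand_of_archSchwartzGL_of_placewise_growth'` (ED. 2) with, at every complex place `w`, the Weil-form quotient `μ_w = dν_w ∕ dρ_w` of Haar measures
(`ν_w` right-invariant: ★ `modularCharacterFun_archLocal_eq_one`; `ρ_w` inversion-invariant: `Z(γ_w)` is abelian, ★ `commute_of_charpoly_separable` at the regular `γ_w`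
(★ `isRegularElt_fst_of_isArchGRegular`), ★ `isInvInvariant_of_comm`; `μ_w ≠ 0`: ★ `quotientMeasure_ne_zero`), and `hplace w` by the regular dichotomy at `γ_w` (LH3-p01's ★ `exists_conj_torusMatrix_or_diagonal_archLocal`,
p849157; regularity per place ★ `charpoly_archPiEquivCM_separable_of_isArchGRegular`): compact torus ↦ ★ `quotientMeasure_hsOrbitBall_le_sqrt_of_elliptic` (p849105); split torus ↦ LH2-p04's ★ `exists_measure_descConj_hs_add_one_le_rpow_of_diag_haar` (p849082) through the carrier
isomorphism `U(Φ₂)(ℂ)_w = U(Φ₂^ℂ)` (★ `antidiagOne_map`) and a Haar frame on the model (★ `modularCharacterFun_unitaryGroupOfForm_eq_one`, ★ `isInvInvariant_of_isMulRightInvariant`).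
HONEST LABEL: this is (CONV) = organ O2's analytic input, now UNCONDITIONAL at every `G`-regular class; it closes no organ of `stub_N9` (O1 Shelstad transfer, O3′ Bouaziz remain LETTERS).
[cite: BeuzartPlessis2020Asterisque, §1.8 p. 39; §1.2 (1.2.2), (1.2.4) p. 21] [cite: Bouaziz1994IntegralesOrbitales, §3.1 p. 579] [cite: Rogawski1990, §4.3 (4.3.1) p. 43; §14.3 p. 234] -/
theorem integrable_orbitalIntegrand_of_archSchwartzGL_of_isArchGRegular
    (νH : Measure ((↥(UnitaryGroup.arch (↥(maximalRealSubfield L)) L (IsCMField.complexConj L) 2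
          (Matrix.of fun i j : Fin 2 => if i.val + j.val + 1 = 2 then (1 : L) else 0)) ×
        ↥(UnitaryGroup.arch (↥(maximalRealSubfield L)) L (IsCMField.complexConj L) 1
          (Matrix.of fun i j : Fin 1 => if i.val + j.val + 1 = 1 then (1 : L) else 0)))))
    [νH.IsHaarMeasure] [νH.IsMulRightInvariant]
    [∀ a : ((↥(UnitaryGroup.arch (↥(maximalRealSubfield L)) L (IsCMField.complexConj L) 2
          (Matrix.of fun i j : Fin 2 => if i.val + j.val + 1 = 2 then (1 : L) else 0)) ×
        ↥(UnitaryGroup.arch (↥(maximalRealSubfield L)) L (IsCMField.complexConj L) 1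
          (Matrix.of fun i j : Fin 1 => if i.val + j.val + 1 = 1 then (1 : L) else 0)))),
      MeasurableSpace (((↥(UnitaryGroup.arch (↥(maximalRealSubfield L)) L (IsCMField.complexConj L) 2
          (Matrix.of fun i j : Fin 2 => if i.val + j.val + 1 = 2 then (1 : L) else 0)) ×
        ↥(UnitaryGroup.arch (↥(maximalRealSubfield L)) L (IsCMField.complexConj L) 1
          (Matrix.of fun i j : Fin 1 => if i.val + j.val + 1 = 1 then (1 : L) else 0)))) ⧸ Subgroup.centralizer ({a} : Set _))]
    [∀ a : ((↥(UnitaryGroup.arch (↥(maximalRealSubfield L)) L (IsCMField.complexConj L) 2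
          (Matrix.of fun i j : Fin 2 => if i.val + j.val + 1 = 2 then (1 : L) else 0)) ×
        ↥(UnitaryGroup.arch (↥(maximalRealSubfield L)) L (IsCMField.complexConj L) 1
          (Matrix.of fun i j : Fin 1 => if i.val + j.val + 1 = 1 then (1 : L) else 0)))),
      BorelSpace (((↥(UnitaryGroup.arch (↥(maximalRealSubfield L)) L (IsCMField.complexConj L) 2
          (Matrix.of fun i j : Fin 2 => if i.val + j.val + 1 = 2 then (1 : L) else 0)) ×
        ↥(UnitaryGroup.arch (↥(maximalRealSubfield L)) L (IsCMField.complexConj L) 1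
          (Matrix.of fun i j : Fin 1 => if i.val + j.val + 1 = 1 then (1 : L) else 0)))) ⧸ Subgroup.centralizer ({a} : Set _))]
    (tH : ∀ γH : ((↥(UnitaryGroup.arch (↥(maximalRealSubfield L)) L (IsCMField.complexConj L) 2
          (Matrix.of fun i j : Fin 2 => if i.val + j.val + 1 = 2 then (1 : L) else 0)) ×
        ↥(UnitaryGroup.arch (↥(maximalRealSubfield L)) L (IsCMField.complexConj L) 1
          (Matrix.of fun i j : Fin 1 => if i.val + j.val + 1 = 1 then (1 : L) else 0)))),
      Measure ↥(Subgroup.centralizer ({γH} : Set _)))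
    (mH : OrbitalMeasureFamily ((↥(UnitaryGroup.arch (↥(maximalRealSubfield L)) L (IsCMField.complexConj L) 2
          (Matrix.of fun i j : Fin 2 => if i.val + j.val + 1 = 2 then (1 : L) else 0)) ×
        ↥(UnitaryGroup.arch (↥(maximalRealSubfield L)) L (IsCMField.complexConj L) 1
          (Matrix.of fun i j : Fin 1 => if i.val + j.val + 1 = 1 then (1 : L) else 0)))))
    (hW : mH.IsQuotientOf (IsArchGRegular L) νH tH)
    (𝔩 : Set (Matrix (Fin 3) (Fin 3) (mixedSpace L)))
    {g : ((↥(UnitaryGroup.arch (↥(maximalRealSubfield L)) L (IsCMField.complexConj L) 2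
          (Matrix.of fun i j : Fin 2 => if i.val + j.val + 1 = 2 then (1 : L) else 0)) ×
        ↥(UnitaryGroup.arch (↥(maximalRealSubfield L)) L (IsCMField.complexConj L) 1
          (Matrix.of fun i j : Fin 1 => if i.val + j.val + 1 = 1 then (1 : L) else 0)))) → ℂ}
    (hg : ArchSchwartzGL L 3 𝔩 (1 / (2 : ℝ)) (fun k => ((endoEmbArch L k).val : GL (Fin 3) (mixedSpace L))) g)
    (c : ConjClasses ((↥(UnitaryGroup.arch (↥(maximalRealSubfield L)) L (IsCMField.complexConj L) 2
          (Matrix.of fun i j : Fin 2 => if i.val + j.val + 1 = 2 then (1 : L) else 0)) ×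
        ↥(UnitaryGroup.arch (↥(maximalRealSubfield L)) L (IsCMField.complexConj L) 1
          (Matrix.of fun i j : Fin 1 => if i.val + j.val + 1 = 1 then (1 : L) else 0)))))
    (hc : IsArchGRegular L (Quotient.out c)) :
    Integrable (descConj (Quotient.out c) (Subgroup.centralizer ({Quotient.out c} : Set _))
      (fun _ h => Subgroup.mem_centralizer_singleton_iff.1 h) g) (mH c) := by
  classical
  /- (0) per-place regularity, hermitian-ness of `Φ₂`, instances on the carriers `U(Φ₂)(ℂ)_w` -/
  have hsep : ∀ w : {w : InfinitePlace L // w.IsComplex},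
      (((((UnitaryGroup.archPiEquivCM 2 L (Matrix.of fun i j : Fin 2 => if i.val + j.val + 1 = 2 then (1 : L) else 0) (Quotient.out c).1 w) : ↥(UnitaryGroup.archLocal L 2 (Matrix.of fun i j : Fin 2 => if i.val + j.val + 1 = 2 then (1 : L) else 0) w)) : GL (Fin 2) ℂ)) : Matrix (Fin 2) (Fin 2) ℂ).charpoly.Separable :=
    charpoly_archPiEquivCM_separable_of_isArchGRegular L (Quotient.out c) hc
  have hherm := UnitaryGroup.antidiagOne_isHermitian L 2
  have hdet : ((Matrix.of fun i j : Fin 2 => if i.val + j.val + 1 = 2 then (1 : L) else 0)).det ≠ 0 := (UnitaryGroup.isUnit_antidiagOne_det L 2).ne_zero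
  haveI hLC : ∀ w : {w : InfinitePlace L // w.IsComplex}, LocallyCompactSpace ↥(UnitaryGroup.archLocal L 2 (Matrix.of fun i j : Fin 2 => if i.val + j.val + 1 = 2 then (1 : L) else 0) w) := fun w =>
    locallyCompactSpace_unitaryGroupOfForm_complex _
  haveI hSC : ∀ w : {w : InfinitePlace L // w.IsComplex}, SecondCountableTopology ↥(UnitaryGroup.archLocal L 2 (Matrix.of fun i j : Fin 2 => if i.val + j.val + 1 = 2 then (1 : L) else 0) w) := fun w =>
    secondCountableTopology_unitaryGroupOfForm_complex _
  letI mG : ∀ w : {w : InfinitePlace L // w.IsComplex}, MeasurableSpace ↥(UnitaryGroup.archLocal L 2 (Matrix.of fun i j : Fin 2 => if i.val + j.val + 1 = 2 then (1 : L) else 0) w) := fun w => borel _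
  haveI bG : ∀ w : {w : InfinitePlace L // w.IsComplex}, BorelSpace ↥(UnitaryGroup.archLocal L 2 (Matrix.of fun i j : Fin 2 => if i.val + j.val + 1 = 2 then (1 : L) else 0) w) := fun w => ⟨rfl⟩
  letI mQ : ∀ w : {w : InfinitePlace L // w.IsComplex}, MeasurableSpace (↥(UnitaryGroup.archLocal L 2 (Matrix.of fun i j : Fin 2 => if i.val + j.val + 1 = 2 then (1 : L) else 0) w) ⧸ Subgroup.centralizer ({(UnitaryGroup.archPiEquivCM 2 L (Matrix.of fun i j : Fin 2 => if i.val + j.val + 1 = 2 then (1 : L) else 0) (Quotient.out c).1 w)} : Set ↥(UnitaryGroup.archLocal L 2 (Matrix.of fun i j : Fin 2 => if i.val + j.val + 1 = 2 then (1 : L) else 0) w))) := fun w => borel _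
  haveI bQ : ∀ w : {w : InfinitePlace L // w.IsComplex}, BorelSpace (↥(UnitaryGroup.archLocal L 2 (Matrix.of fun i j : Fin 2 => if i.val + j.val + 1 = 2 then (1 : L) else 0) w) ⧸ Subgroup.centralizer ({(UnitaryGroup.archPiEquivCM 2 L (Matrix.of fun i j : Fin 2 => if i.val + j.val + 1 = 2 then (1 : L) else 0) (Quotient.out c).1 w)} : Set ↥(UnitaryGroup.archLocal L 2 (Matrix.of fun i j : Fin 2 => if i.val + j.val + 1 = 2 then (1 : L) else 0) w))) := fun w => ⟨rfl⟩
  haveI hLCZ : ∀ w : {w : InfinitePlace L // w.IsComplex}, LocallyCompactSpace ↥(Subgroup.centralizer ({(UnitaryGroup.archPiEquivCM 2 L (Matrix.of fun i j : Fin 2 => if i.val + j.val + 1 = 2 then (1 : L) else 0) (Quotient.out c).1 w)} : Set ↥(UnitaryGroup.archLocal L 2 (Matrix.of fun i j : Fin 2 => if i.val + j.val + 1 = 2 then (1 : L) else 0) w))) := fun w =>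
    (isClosed_coe_centralizer_singleton _).isClosedEmbedding_subtypeVal.locallyCompactSpace
  /- (1) the Haar data and the Weil-form quotient measures `μ_w = dν_w ∕ dρ_w` -/
  let νw : ∀ w : {w : InfinitePlace L // w.IsComplex}, Measure ↥(UnitaryGroup.archLocal L 2 (Matrix.of fun i j : Fin 2 => if i.val + j.val + 1 = 2 then (1 : L) else 0) w) := fun w => Measure.haarMeasure (Classical.arbitrary _)
  haveI hνR : ∀ w : {w : InfinitePlace L // w.IsComplex}, (νw w).IsMulRightInvariant := fun w =>
    isMulRightInvariant_of_modularCharacterFun_eq_one (UnitaryGroup.modularCharacterFun_archLocal_eq_one L _ hherm hdet w) _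
  let ρw : ∀ w : {w : InfinitePlace L // w.IsComplex}, Measure ↥(Subgroup.centralizer ({(UnitaryGroup.archPiEquivCM 2 L (Matrix.of fun i j : Fin 2 => if i.val + j.val + 1 = 2 then (1 : L) else 0) (Quotient.out c).1 w)} : Set ↥(UnitaryGroup.archLocal L 2 (Matrix.of fun i j : Fin 2 => if i.val + j.val + 1 = 2 then (1 : L) else 0) w))) := fun w => Measure.haarMeasure (Classical.arbitrary _)
  haveI hρI : ∀ w : {w : InfinitePlace L // w.IsComplex}, (ρw w).IsInvInvariant := fun w =>
    isInvInvariant_of_comm _ (isClosed_coe_centralizer_singleton _) (centralizer_comm_of_charpoly_separable_GL₂ _ (hsep w)) (ρw w)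
  let μw : ∀ w : {w : InfinitePlace L // w.IsComplex}, Measure (↥(UnitaryGroup.archLocal L 2 (Matrix.of fun i j : Fin 2 => if i.val + j.val + 1 = 2 then (1 : L) else 0) w) ⧸ Subgroup.centralizer ({(UnitaryGroup.archPiEquivCM 2 L (Matrix.of fun i j : Fin 2 => if i.val + j.val + 1 = 2 then (1 : L) else 0) (Quotient.out c).1 w)} : Set ↥(UnitaryGroup.archLocal L 2 (Matrix.of fun i j : Fin 2 => if i.val + j.val + 1 = 2 then (1 : L) else 0) w))) := fun w =>
    quotientMeasure (Subgroup.centralizer ({(UnitaryGroup.archPiEquivCM 2 L (Matrix.of fun i j : Fin 2 => if i.val + j.val + 1 = 2 then (1 : L) else 0) (Quotient.out c).1 w)} : Set ↥(UnitaryGroup.archLocal L 2 (Matrix.of fun i j : Fin 2 => if i.val + j.val + 1 = 2 then (1 : L) else 0) w))) (ρw w) (isClosed_coe_centralizer_singleton _) (νw w)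
  haveI hμS : ∀ w : {w : InfinitePlace L // w.IsComplex}, SMulInvariantMeasure ↥(UnitaryGroup.archLocal L 2 (Matrix.of fun i j : Fin 2 => if i.val + j.val + 1 = 2 then (1 : L) else 0) w) (↥(UnitaryGroup.archLocal L 2 (Matrix.of fun i j : Fin 2 => if i.val + j.val + 1 = 2 then (1 : L) else 0) w) ⧸ Subgroup.centralizer ({(UnitaryGroup.archPiEquivCM 2 L (Matrix.of fun i j : Fin 2 => if i.val + j.val + 1 = 2 then (1 : L) else 0) (Quotient.out c).1 w)} : Set ↥(UnitaryGroup.archLocal L 2 (Matrix.of fun i j : Fin 2 => if i.val + j.val + 1 = 2 then (1 : L) else 0) w))) (μw w) := fun w =>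
    smulInvariantMeasure_quotientMeasure _ _ _ _
  have hμ0 : ∀ w, μw w ≠ 0 := fun w => quotientMeasure_ne_zero _ _ _ _
  refine integrable_orbitalIntegrand_of_archSchwartzGL_of_placewise_growth' νH tH mH hW 𝔩 hg c hc μw hμ0 fun w => ?_
  /- (2) `hplace w` by the regular dichotomy at `γ_w` (★ `exists_conj_torusMatrix_or_diagonal_archLocal`, LH3-p01) -/
  rcases exists_conj_torusMatrix_or_diagonal_archLocal L w (UnitaryGroup.archPiEquivCM 2 L (Matrix.of fun i j : Fin 2 => if i.val + j.val + 1 = 2 then (1 : L) else 0) (Quotient.out c).1 w) (hsep w) with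
    ⟨g₀, l₁, l₂, hne, hγ⟩ | ⟨h, δ, l₁, l₂, hne, hδ, hconj⟩
  · /- compact torus: ★ `quotientMeasure_hsOrbitBall_le_sqrt_of_elliptic` (p849105) -/
    exact quotientMeasure_hsOrbitBall_le_sqrt_of_elliptic L w (νw w) _ g₀ hne hγ (ρw w)
  · /- split torus: LH2-p04's ★ `exists_measure_descConj_hs_add_one_le_rpow_of_diag_haar` (p849082) through the carrier identity `U(Φ₂)(ℂ)_w = U(Φ₂^ℂ)` -/
    have hEq : UnitaryGroup.archLocal L 2 (Matrix.of fun i j : Fin 2 => if i.val + j.val + 1 = 2 then (1 : L) else 0) w = unitaryGroupOfForm (starRingEnd ℂ) (Matrix.of fun i j : Fin 2 => if i.val + j.val + 1 = 2 then (1 : ℂ) else 0) := by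
      show unitaryGroupOfForm (starRingEnd ℂ) (((Matrix.of fun i j : Fin 2 => if i.val + j.val + 1 = 2 then (1 : L) else 0)).map w.1.embedding) = _
      rw [antidiagOne_map]
    haveI : LocallyCompactSpace ↥(unitaryGroupOfForm (starRingEnd ℂ) (Matrix.of fun i j : Fin 2 => if i.val + j.val + 1 = 2 then (1 : ℂ) else 0)) := locallyCompactSpace_unitaryGroupOfForm_complex _
    haveI : SecondCountableTopology ↥(unitaryGroupOfForm (starRingEnd ℂ) (Matrix.of fun i j : Fin 2 => if i.val + j.val + 1 = 2 then (1 : ℂ) else 0)) := secondCountableTopology_unitaryGroupOfForm_complex _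
    letI : MeasurableSpace ↥(unitaryGroupOfForm (starRingEnd ℂ) (Matrix.of fun i j : Fin 2 => if i.val + j.val + 1 = 2 then (1 : ℂ) else 0)) := borel _
    haveI : BorelSpace ↥(unitaryGroupOfForm (starRingEnd ℂ) (Matrix.of fun i j : Fin 2 => if i.val + j.val + 1 = 2 then (1 : ℂ) else 0)) := ⟨rfl⟩
    letI : MeasurableSpace Circle := borel _
    haveI : BorelSpace Circle := ⟨rfl⟩
    letI : MeasurableSpace (Matrix (Fin 2) (Fin 2) ℝ) := borel _
    haveI : BorelSpace (Matrix (Fin 2) (Fin 2) ℝ) := ⟨rfl⟩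
    letI : MeasurableSpace (Matrix (Fin 2) (Fin 2) ℂ) := borel _
    haveI : BorelSpace (Matrix (Fin 2) (Fin 2) ℂ) := ⟨rfl⟩
    let e : ↥(UnitaryGroup.archLocal L 2 (Matrix.of fun i j : Fin 2 => if i.val + j.val + 1 = 2 then (1 : L) else 0) w) ≃* ↥(unitaryGroupOfForm (starRingEnd ℂ) (Matrix.of fun i j : Fin 2 => if i.val + j.val + 1 = 2 then (1 : ℂ) else 0)) := MulEquiv.subgroupCongr hEq
    have hecoe : ∀ y : ↥(UnitaryGroup.archLocal L 2 (Matrix.of fun i j : Fin 2 => if i.val + j.val + 1 = 2 then (1 : L) else 0) w), ((e y : ↥(unitaryGroupOfForm (starRingEnd ℂ) (Matrix.of fun i j : Fin 2 => if i.val + j.val + 1 = 2 then (1 : ℂ) else 0))) : GL (Fin 2) ℂ) = (y : GL (Fin 2) ℂ) := fun y => rfl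
    have he : Continuous e := by
      rw [Topology.IsInducing.subtypeVal.continuous_iff]
      exact continuous_subtype_val
    have hes : Continuous e.symm := by
      rw [Topology.IsInducing.subtypeVal.continuous_iff]
      exact continuous_subtype_val
    -- the split data read in the model group
    have hγ' : (((e δ : ↥(unitaryGroupOfForm (starRingEnd ℂ) (Matrix.of fun i j : Fin 2 => if i.val + j.val + 1 = 2 then (1 : ℂ) else 0))) : GL (Fin 2) ℂ) : Matrix (Fin 2) (Fin 2) ℂ) = !![l₁, 0; 0, l₂] := by
      rw [hecoe]; exact hδ
    have hconj' : e (UnitaryGroup.archPiEquivCM 2 L (Matrix.of fun i j : Fin 2 => if i.val + j.val + 1 = 2 then (1 : L) else 0) (Quotient.out c).1 w) = e h * e δ * (e h)⁻¹ := by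
      rw [hconj, map_mul, map_mul, map_inv]
    have hsep' : ((((e δ : ↥(unitaryGroupOfForm (starRingEnd ℂ) (Matrix.of fun i j : Fin 2 => if i.val + j.val + 1 = 2 then (1 : ℂ) else 0))) : GL (Fin 2) ℂ)) : Matrix (Fin 2) (Fin 2) ℂ).charpoly.Separable := by
      have h2 : ((e δ : ↥(unitaryGroupOfForm (starRingEnd ℂ) (Matrix.of fun i j : Fin 2 => if i.val + j.val + 1 = 2 then (1 : ℂ) else 0))) : GL (Fin 2) ℂ) = ((h : GL (Fin 2) ℂ))⁻¹ * (((UnitaryGroup.archPiEquivCM 2 L (Matrix.of fun i j : Fin 2 => if i.val + j.val + 1 = 2 then (1 : L) else 0) (Quotient.out c).1 w) : ↥(UnitaryGroup.archLocal L 2 (Matrix.of fun i j : Fin 2 => if i.val + j.val + 1 = 2 then (1 : L) else 0) w)) : GL (Fin 2) ℂ) * (((h : GL (Fin 2) ℂ))⁻¹)⁻¹ := by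
        rw [hecoe, inv_inv, hconj, Subgroup.coe_mul, Subgroup.coe_mul, Subgroup.coe_inv]
        group
      rw [h2]
      exact (isRegularElt_conj_iff _ _).2 (hsep w)
    haveI : LocallyCompactSpace ↥(Subgroup.centralizer ({e δ} : Set ↥(unitaryGroupOfForm (starRingEnd ℂ) (Matrix.of fun i j : Fin 2 => if i.val + j.val + 1 = 2 then (1 : ℂ) else 0)))) :=
      (isClosed_coe_centralizer_singleton _).isClosedEmbedding_subtypeVal.locallyCompactSpace
    -- the model Haar frame
    have hHC : ((Matrix.of fun i j : Fin 2 => if i.val + j.val + 1 = 2 then (1 : ℂ) else 0)).IsHermitian := by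
      have h1 := UnitaryGroup.isHermitian_map_embedding L hherm w.1.embedding
      rwa [antidiagOne_map] at h1
    have hdC : ((Matrix.of fun i j : Fin 2 => if i.val + j.val + 1 = 2 then (1 : ℂ) else 0)).det ≠ 0 := by
      have h1 := UnitaryGroup.det_map_embedding_ne_zero L hdet w.1.embedding
      rwa [antidiagOne_map] at h1
    let ν : Measure ↥(unitaryGroupOfForm (starRingEnd ℂ) (Matrix.of fun i j : Fin 2 => if i.val + j.val + 1 = 2 then (1 : ℂ) else 0)) := Measure.haarMeasure (Classical.arbitrary _)
    haveI : ν.IsMulRightInvariant := isMulRightInvariant_of_modularCharacterFun_eq_one (modularCharacterFun_unitaryGroupOfForm_eq_one hHC hdC) ν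
    haveI : ν.IsInvInvariant := isInvInvariant_of_isMulRightInvariant ν
    let ρ : Measure ↥(Subgroup.centralizer ({e δ} : Set ↥(unitaryGroupOfForm (starRingEnd ℂ) (Matrix.of fun i j : Fin 2 => if i.val + j.val + 1 = 2 then (1 : ℂ) else 0)))) := Measure.haarMeasure (Classical.arbitrary _)
    haveI : ρ.IsInvInvariant :=
      isInvInvariant_of_comm _ (isClosed_coe_centralizer_singleton _) (centralizer_comm_of_charpoly_separable_GL₂ _ hsep') ρ
    letI : MeasurableSpace (↥(unitaryGroupOfForm (starRingEnd ℂ) (Matrix.of fun i j : Fin 2 => if i.val + j.val + 1 = 2 then (1 : ℂ) else 0)) ⧸ Subgroup.centralizer ({e δ} : Set ↥(unitaryGroupOfForm (starRingEnd ℂ) (Matrix.of fun i j : Fin 2 => if i.val + j.val + 1 = 2 then (1 : ℂ) else 0)))) := borel _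
    haveI : BorelSpace (↥(unitaryGroupOfForm (starRingEnd ℂ) (Matrix.of fun i j : Fin 2 => if i.val + j.val + 1 = 2 then (1 : ℂ) else 0)) ⧸ Subgroup.centralizer ({e δ} : Set ↥(unitaryGroupOfForm (starRingEnd ℂ) (Matrix.of fun i j : Fin 2 => if i.val + j.val + 1 = 2 then (1 : ℂ) else 0)))) := ⟨rfl⟩
    exact exists_measure_descConj_hs_add_one_le_rpow_of_diag_haar e he hes hγ' hne ν ρ (e h) hconj' (μw w)

end Final

end Literature.NumberTheory.Rogawski1990

end
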